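import Summits.Ventures.PercRepro.LemmaBAbstract
/-!
# PercRepro — the two-copy sum grouped by join and meet: abstract Lemma B ⇒ abstract C-005 (typer-2)

Identity (1) of the lead's canonical chain (INBOX 2026-08-22T02:29:17Z; p3 §1, p4 Theorem A): for two
independent copies `ω, ω'`, `w(ω) w(ω') = w(ω ⊔ ω') w(ω ⊓ ω')`, so a two-copy sum groups by
`(u, v) = (ω ⊔ ω', ω ⊓ ω')`; the fibre over `v ≤ u` is the cube of the interval `[v, u]` (`Face u v`,
`embed`), on which the two copies are antipodal (`ρ ↦ ρᶜ`). Hence `N(c, c) = Σ_{v ≤ u} w(u) w(v) ·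
2·(topBotCount − crossCount)` of the face map `c ∘ embed`, and the abstract Lemma B makes every term
nonnegative: **`C005abstract_of_LemmaBAbstract`**, **`C005_of_LemmaBAbstract`**, **`C005_of_UFL3`**.
(typer-1's `PairGrouping.lean` and p3's `LemmaB.lean` carry the per-graph version of the identity;
this file is the self-contained abstract route.)
-/

namespace PercRepro
open Finset
section Face
variable {E : Type*}

/-- The cube of the interval `[v, u]`: the edges open in `u` and closed in `v`. -/
abbrev Face (u v : Config E) : Type _ := {e : E // v e = false ∧ u e = true}

/-- A configuration of the face cube, embedded into the interval `[v, u]`. -/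
def embed (u v : Config E) (ρ : Config (Face u v)) : Config E :=
  fun e => if h : v e = false ∧ u e = true then ρ ⟨e, h⟩ else v e

/-- Restriction of a configuration to the face cube. -/
def restrict (u v : Config E) (ω : Config E) : Config (Face u v) := fun e => ω e.1

/-- The embedding is monotone. -/
theorem embed_mono (u v : Config E) : Monotone (embed u v) := by
  intro ρ ρ' h e
  unfold embed
  split_ifs with he
  · exact h ⟨e, he⟩
  · exact le_rfl

/-- The embedding on a face edge. -/
theorem embed_apply_of_mem (u v : Config E) (ρ : Config (Face u v)) {e : E}
    (h : v e = false ∧ u e = true) : embed u v ρ e = ρ ⟨e, h⟩ := by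
  simp [embed, h]

/-- The embedding off the face. -/
theorem embed_apply_of_not (u v : Config E) (ρ : Config (Face u v)) {e : E}
    (h : ¬ (v e = false ∧ u e = true)) : embed u v ρ e = v e := by
  simp [embed, h]

/-- Restricting an embedded configuration gives it back. -/
theorem restrict_embed (u v : Config E) (ρ : Config (Face u v)) :
    restrict u v (embed u v ρ) = ρ := by
  funext ⟨e, he⟩
  simp [restrict, embed, he]

/-- The antipodal pair of the face joins to `u`. -/
theorem embed_sup_embed_compl {u v : Config E} (hvu : v ≤ u) (ρ : Config (Face u v)) :
    embed u v ρ ⊔ embed u v ρᶜ = u := by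
  funext e
  have hve := hvu e
  simp only [Pi.sup_apply]
  by_cases h : v e = false ∧ u e = true
  · rw [embed_apply_of_mem u v ρ h, embed_apply_of_mem u v ρᶜ h, Pi.compl_apply, h.2]
    cases ρ ⟨e, h⟩ <;> rfl
  · rw [embed_apply_of_not u v ρ h, embed_apply_of_not u v ρᶜ h, sup_idem]
    revert h hve
    cases v e <;> cases u e <;> simp

/-- The antipodal pair of the face meets in `v`. -/
theorem embed_inf_embed_compl (u v : Config E) (ρ : Config (Face u v)) :
    embed u v ρ ⊓ embed u v ρᶜ = v := by
  funext e
  simp only [Pi.inf_apply]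
  by_cases h : v e = false ∧ u e = true
  · rw [embed_apply_of_mem u v ρ h, embed_apply_of_mem u v ρᶜ h, Pi.compl_apply, h.1]
    cases ρ ⟨e, h⟩ <;> rfl
  · rw [embed_apply_of_not u v ρ h, embed_apply_of_not u v ρᶜ h, inf_idem]

/-- A pair with join `u` and meet `v` is an antipodal pair of the face. -/
theorem eq_embed_of_sup_inf {u v ω ω' : Config E} (hs : ω ⊔ ω' = u) (hi : ω ⊓ ω' = v) :
    ω = embed u v (restrict u v ω) ∧ ω' = embed u v (restrict u v ω)ᶜ := by
  subst hs hi
  constructor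
  · funext e
    by_cases h : (ω ⊓ ω') e = false ∧ (ω ⊔ ω') e = true
    · rw [embed_apply_of_mem _ _ _ h]
      rfl
    · rw [embed_apply_of_not _ _ _ h]
      revert h
      simp only [Pi.inf_apply, Pi.sup_apply]
      cases ω e <;> cases ω' e <;> simp
  · funext e
    by_cases h : (ω ⊓ ω') e = false ∧ (ω ⊔ ω') e = true
    · rw [embed_apply_of_mem _ _ _ h, Pi.compl_apply]
      show ω' e = !ω e
      revert h
      simp only [Pi.inf_apply, Pi.sup_apply]
      cases ω e <;> cases ω' e <;> simp
    · rw [embed_apply_of_not _ _ _ h]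
      revert h
      simp only [Pi.inf_apply, Pi.sup_apply]
      cases ω e <;> cases ω' e <;> simp

variable [Fintype E] [DecidableEq E]

/-- The fibre of `(ω, ω') ↦ (ω ⊔ ω', ω ⊓ ω')` over `(u, v)`. -/
def fibre (u v : Config E) : Finset (Config E × Config E) :=
  Finset.univ.filter fun p => p.1 ⊔ p.2 = u ∧ p.1 ⊓ p.2 = v

/-- The fibre over `(u, v)` is empty unless `v ≤ u`. -/
theorem fibre_eq_empty {u v : Config E} (h : ¬ v ≤ u) : fibre u v = ∅ := by
  rw [fibre, Finset.filter_eq_empty_iff]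
  rintro ⟨ω, ω'⟩ -
  rintro ⟨rfl, rfl⟩
  exact h inf_le_sup

/-- A sum over the fibre over `(u, v)`, `v ≤ u`, is a sum over the antipodal pairs of the face. -/
theorem sum_fibre {M : Type*} [AddCommMonoid M] {u v : Config E} (hvu : v ≤ u)
    (g : Config E × Config E → M) :
    ∑ p ∈ fibre u v, g p = ∑ ρ : Config (Face u v), g (embed u v ρ, embed u v ρᶜ) := by
  symm
  refine Finset.sum_nbij' (fun ρ => (embed u v ρ, embed u v ρᶜ)) (fun p => restrict u v p.1)
    ?_ ?_ ?_ ?_ ?_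
  · intro ρ _
    simp only [fibre, Finset.mem_filter, Finset.mem_univ, true_and]
    exact ⟨embed_sup_embed_compl hvu ρ, embed_inf_embed_compl u v ρ⟩
  · intro p _
    exact Finset.mem_univ _
  · intro ρ _
    exact restrict_embed u v ρ
  · rintro ⟨ω, ω'⟩ hp
    simp only [fibre, Finset.mem_filter, Finset.mem_univ, true_and] at hp
    obtain ⟨h1, h2⟩ := eq_embed_of_sup_inf hp.1 hp.2
    exact Prod.ext h1.symm h2.symm
  · intro ρ _
    rfl

end Face

/-! ### The two-copy kernel of a crossing family and its antipodal sum on a cube -/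

section Antipodal

variable {k r : ℕ}

open Classical in
/-- The pointwise two-copy kernel of a family `x`: `[σ=⊤ ∧ τ=⊥] + [σ=⊥ ∧ τ=⊤] − #{(i,j) : i ≠ j,
τ = x i, σ = x j}`; for `x = cross4` it is the kernel of `N(c, c')`. -/
noncomputable def crossKernel (x : Fin r → Setoid (Fin k)) (σ τ : Setoid (Fin k)) : ℝ :=
  (if σ = ⊤ ∧ τ = ⊥ then 1 else 0) + (if σ = ⊥ ∧ τ = ⊤ then 1 else 0) -
    ∑ i : Fin r, ∑ j : Fin r, if i ≠ j ∧ τ = x i ∧ σ = x j then 1 else 0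

/-- The kernel of `N(c, c')` (four indices, the three crossing partitions). -/
noncomputable abbrev nestedKernel : Setoid (Fin 4) → Setoid (Fin 4) → ℝ := crossKernel cross4

open Classical in
/-- The crossing part of the kernel is the indicator of "two distinct cells of `x`". -/
theorem sum_cross_ite {x : Fin r → Setoid (Fin k)} (hx : Function.Injective x)
    (σ τ : Setoid (Fin k)) :
    (∑ i : Fin r, ∑ j : Fin r, if i ≠ j ∧ τ = x i ∧ σ = x j then (1 : ℝ) else 0) =
      if ∃ i j : Fin r, i ≠ j ∧ τ = x i ∧ σ = x j then 1 else 0 := by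
  by_cases h : ∃ i j : Fin r, i ≠ j ∧ τ = x i ∧ σ = x j
  · obtain ⟨i₀, j₀, hne, hτ, hσ⟩ := h
    rw [if_pos ⟨i₀, j₀, hne, hτ, hσ⟩, Finset.sum_eq_single i₀]
    · rw [Finset.sum_eq_single j₀]
      · rw [if_pos ⟨hne, hτ, hσ⟩]
      · intro j _ hj
        rw [if_neg]
        rintro ⟨-, -, hσ'⟩
        exact hj (hx (hσ'.symm.trans hσ))
      · intro h
        exact absurd (Finset.mem_univ _) h
    · intro i _ hi
      refine Finset.sum_eq_zero fun j _ => ?_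
      rw [if_neg]
      rintro ⟨-, hτ', -⟩
      exact hi (hx (hτ'.symm.trans hτ))
    · intro h
      exact absurd (Finset.mem_univ _) h
  · rw [if_neg h]
    refine Finset.sum_eq_zero fun i _ => Finset.sum_eq_zero fun j _ => ?_
    rw [if_neg]
    intro hh
    exact h ⟨i, j, hh⟩

variable {S : Type*} [Fintype S] [DecidableEq S]

/-- Complementation as a permutation of the cube. -/
def complPerm : Equiv.Perm (Config S) := Function.Involutive.toPerm compl compl_compl

open Classical in
/-- `topBotCount` as a real sum. -/
theorem topBotCount_eq_sum (c : Config S → Setoid (Fin k)) :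
    (topBotCount c : ℝ) = ∑ ρ : Config S, if c ρ = ⊤ ∧ c ρᶜ = ⊥ then 1 else 0 := by
  rw [topBotCount, Finset.card_filter]
  push_cast
  rfl

open Classical in
/-- `(⊥, ⊤)` pairs are `(⊤, ⊥)` pairs read from the other end. -/
theorem sum_botTop_eq (c : Config S → Setoid (Fin k)) :
    (∑ ρ : Config S, if c ρ = ⊥ ∧ c ρᶜ = ⊤ then (1 : ℝ) else 0) = topBotCount c := by
  rw [topBotCount_eq_sum]
  refine Fintype.sum_equiv complPerm _ _ fun ρ => ?_
  simp only [complPerm, Function.Involutive.coe_toPerm, compl_compl]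
  by_cases h : c ρ = ⊥ ∧ c ρᶜ = ⊤
  · rw [if_pos h, if_pos h.symm]
  · rw [if_neg h, if_neg fun h' => h h'.symm]

open Classical in
/-- Distinct-cell pairs, counted from either end, are twice `crossCount`. -/
theorem sum_distinctCross_eq {x : Fin r → Setoid (Fin k)} (hx : Function.Injective x)
    (c : Config S → Setoid (Fin k)) :
    (∑ ρ : Config S, if ∃ i j : Fin r, i ≠ j ∧ c ρᶜ = x i ∧ c ρ = x j then (1 : ℝ) else 0)
      = 2 * crossCount x c := by
  set C := Finset.univ.filter fun ρ : Config S =>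
    ∃ i j : Fin r, i < j ∧ c ρ = x i ∧ c ρᶜ = x j with hC
  set C' := Finset.univ.filter fun ρ : Config S =>
    ∃ i j : Fin r, i < j ∧ c ρᶜ = x i ∧ c ρ = x j with hC'
  have hD : (Finset.univ.filter fun ρ : Config S =>
      ∃ i j : Fin r, i ≠ j ∧ c ρᶜ = x i ∧ c ρ = x j) = C ∪ C' := by
    ext ρ
    simp only [hC, hC', Finset.mem_filter, Finset.mem_univ, true_and, Finset.mem_union]
    constructor
    · rintro ⟨i, j, hij, h1, h2⟩
      rcases lt_or_gt_of_ne hij with h | h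
      · exact Or.inr ⟨i, j, h, h1, h2⟩
      · exact Or.inl ⟨j, i, h, h2, h1⟩
    · rintro (⟨i, j, hij, h1, h2⟩ | ⟨i, j, hij, h1, h2⟩)
      · exact ⟨j, i, hij.ne', h2, h1⟩
      · exact ⟨i, j, hij.ne, h1, h2⟩
  have hdisj : Disjoint C C' := by
    rw [Finset.disjoint_left]
    intro ρ h1 h2
    simp only [hC, hC', Finset.mem_filter, Finset.mem_univ, true_and] at h1 h2
    obtain ⟨a, b, hab, ha, hb⟩ := h1
    obtain ⟨a', b', hab', ha', hb'⟩ := h2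
    have e1 := hx (ha.symm.trans hb')
    have e2 := hx (hb.symm.trans ha')
    subst e1 e2
    exact absurd (hab.trans hab') (lt_irrefl _)
  have hC'card : C'.card = C.card := by
    rw [hC', hC]
    refine Finset.card_bij (fun ρ _ => ρᶜ) ?_ ?_ ?_
    · intro ρ hρ
      simp only [Finset.mem_filter, Finset.mem_univ, true_and] at hρ ⊢
      obtain ⟨i, j, hij, h1, h2⟩ := hρ
      exact ⟨i, j, hij, h1, by rw [compl_compl]; exact h2⟩
    · intro ρ _ ρ' _ h
      exact compl_injective h
    · intro ρ hρ
      refine ⟨ρᶜ, ?_, compl_compl ρ⟩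
      simp only [Finset.mem_filter, Finset.mem_univ, true_and] at hρ ⊢
      obtain ⟨i, j, hij, h1, h2⟩ := hρ
      exact ⟨i, j, hij, by rw [compl_compl]; exact h1, h2⟩
  have hsum : (∑ ρ : Config S, if ∃ i j : Fin r, i ≠ j ∧ c ρᶜ = x i ∧ c ρ = x j
      then (1 : ℝ) else 0) = ((Finset.univ.filter fun ρ : Config S =>
        ∃ i j : Fin r, i ≠ j ∧ c ρᶜ = x i ∧ c ρ = x j).card : ℝ) := by
    rw [Finset.card_filter]
    push_cast
    rfl
  rw [hsum, hD, Finset.card_union_of_disjoint hdisj, hC'card, crossCount]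
  push_cast
  ring

open Classical in
/-- **The antipodal sum of the kernel on a cube** is `2·(topBotCount − crossCount)`. -/
theorem sum_crossKernel_compl {x : Fin r → Setoid (Fin k)} (hx : Function.Injective x)
    (c : Config S → Setoid (Fin k)) :
    ∑ ρ : Config S, crossKernel x (c ρ) (c ρᶜ) = 2 * (topBotCount c - crossCount x c : ℝ) := by
  simp only [crossKernel, sum_cross_ite hx, Finset.sum_add_distrib, Finset.sum_sub_distrib]
  rw [← topBotCount_eq_sum, sum_botTop_eq, sum_distinctCross_eq hx]
  ring

/-- Under Lemma B for the family the antipodal sum of its kernel is nonnegative for monotone maps. -/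
theorem sum_crossKernel_compl_nonneg {x : Fin r → Setoid (Fin k)} (hx : Function.Injective x)
    (hB : LemmaBFamily x) {S : Type} [Fintype S] [DecidableEq S]
    (c : Config S → Setoid (Fin k)) (hc : Monotone c) :
    0 ≤ ∑ ρ : Config S, crossKernel x (c ρ) (c ρᶜ) := by
  rw [sum_crossKernel_compl hx]
  have := hB c hc
  have h' : (crossCount x c : ℝ) ≤ topBotCount c := by exact_mod_cast this
  linarith

end Antipodal

/-! ### `N(c, c')` as a two-copy sum, grouped by join and meet -/

section Grouping

variable {E : Type*} [Fintype E] [DecidableEq E]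

open Classical in
/-- **`N(c, c')` is the two-copy sum of the kernel.** -/
theorem nestedForm_eq_double_sum (p : E → ℝ) (c c' : Config E → Setoid (Fin 4)) :
    nestedForm p c c' = ∑ ω : Config E, ∑ ω' : Config E,
      weight p ω * weight p ω' * nestedKernel (c ω) (c' ω') := by
  have e1 : prob p {ω | c' ω = ⊤} * prob p {ω | c ω = ⊥} =
      ∑ ω : Config E, ∑ ω' : Config E, weight p ω * weight p ω' *
        if c ω = ⊥ ∧ c' ω' = ⊤ then 1 else 0 := by
    rw [mul_comm, prob_mul_prob_eq]
  have e2 : prob p {ω | c ω = ⊤} * prob p {ω | c' ω = ⊥} =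
      ∑ ω : Config E, ∑ ω' : Config E, weight p ω * weight p ω' *
        if c ω = ⊤ ∧ c' ω' = ⊥ then 1 else 0 := prob_mul_prob_eq p _ _
  have e3 : ∀ i j : Fin 3, (if i ≠ j then prob p {ω | c' ω = cross4 i} * prob p {ω | c ω = cross4 j}
      else 0) = ∑ ω : Config E, ∑ ω' : Config E, weight p ω * weight p ω' *
        if i ≠ j ∧ c' ω' = cross4 i ∧ c ω = cross4 j then 1 else 0 := by
    intro i j
    by_cases hij : i ≠ j
    · rw [if_pos hij, mul_comm, prob_mul_prob_eq]
      refine Finset.sum_congr rfl fun ω _ => Finset.sum_congr rfl fun ω' _ => ?_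
      by_cases h1 : c ω = cross4 j <;> by_cases h2 : c' ω' = cross4 i <;> simp [h1, h2, hij]
    · rw [if_neg hij]
      simp [hij]
  have hR : ∑ ω : Config E, ∑ ω' : Config E, weight p ω * weight p ω' * nestedKernel (c ω) (c' ω')
      = (∑ ω : Config E, ∑ ω' : Config E, weight p ω * weight p ω' *
          if c ω = ⊤ ∧ c' ω' = ⊥ then 1 else 0) +
        (∑ ω : Config E, ∑ ω' : Config E, weight p ω * weight p ω' *
          if c ω = ⊥ ∧ c' ω' = ⊤ then 1 else 0) -
        ∑ ω : Config E, ∑ ω' : Config E, ∑ i : Fin 3, ∑ j : Fin 3, weight p ω * weight p ω' *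
          if i ≠ j ∧ c' ω' = cross4 i ∧ c ω = cross4 j then 1 else 0 := by
    simp only [nestedKernel, crossKernel, mul_add, mul_sub, Finset.mul_sum,
      Finset.sum_add_distrib, Finset.sum_sub_distrib]
  rw [hR, ← sum_comm4]
  unfold nestedForm
  rw [e1, e2]
  simp only [e3]
  ring

open Classical in
/-- **Any two-copy sum grouped by join and meet** (kernel `K` and map `c` arbitrary): a sum over
`(u, v)`, `v ≤ u`, of `w(u) w(v)` times the antipodal sum of `K ∘ c` on the face cube of `[v, u]`. -/
theorem twoCopy_eq_sum_faces {ι : Type*} (p : E → ℝ) (c : Config E → ι) (K : ι → ι → ℝ) :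
    ∑ ω : Config E, ∑ ω' : Config E, weight p ω * weight p ω' * K (c ω) (c ω') =
      ∑ uv : Config E × Config E, weight p uv.2 * weight p uv.1 *
        if uv.2 ≤ uv.1 then ∑ ρ : Config (Face uv.1 uv.2),
          K (c (embed uv.1 uv.2 ρ)) (c (embed uv.1 uv.2 ρᶜ)) else 0 := by
  have hw : ∑ ω : Config E, ∑ ω' : Config E, weight p ω * weight p ω' * K (c ω) (c ω')
      = ∑ ω : Config E, ∑ ω' : Config E,
        weight p (ω ⊓ ω') * weight p (ω ⊔ ω') * K (c ω) (c ω') :=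
    Finset.sum_congr rfl fun ω _ => Finset.sum_congr rfl fun ω' _ => by
      rw [weight_inf_mul_weight_sup p ω ω']
  rw [hw, ← Fintype.sum_prod_type']
  rw [← Finset.sum_fiberwise (Finset.univ : Finset (Config E × Config E))
    (fun q => (q.1 ⊔ q.2, q.1 ⊓ q.2))]
  refine Finset.sum_congr rfl fun uv _ => ?_
  have hfil : (Finset.univ.filter fun q : Config E × Config E => (q.1 ⊔ q.2, q.1 ⊓ q.2) = uv) =
      fibre uv.1 uv.2 := by
    ext q
    simp [fibre, Prod.ext_iff]
  rw [hfil]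
  have hterm : ∀ q ∈ fibre uv.1 uv.2, weight p (q.1 ⊓ q.2) * weight p (q.1 ⊔ q.2) *
      K (c q.1) (c q.2) = weight p uv.2 * weight p uv.1 * K (c q.1) (c q.2) := by
    intro q hq
    simp only [fibre, Finset.mem_filter, Finset.mem_univ, true_and] at hq
    rw [hq.1, hq.2]
  rw [Finset.sum_congr rfl hterm, ← Finset.mul_sum]
  congr 1
  by_cases hle : uv.2 ≤ uv.1
  · rw [if_pos hle, sum_fibre hle]
  · rw [if_neg hle, fibre_eq_empty hle, Finset.sum_empty]

open Classical in
/-- **`N(c, c)` grouped by join and meet**: the instance of `twoCopy_eq_sum_faces` at the kernel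
of `N`. -/
theorem nestedForm_self_eq_sum_faces (p : E → ℝ) (c : Config E → Setoid (Fin 4)) :
    nestedForm p c c = ∑ uv : Config E × Config E, weight p uv.2 * weight p uv.1 *
      if uv.2 ≤ uv.1 then ∑ ρ : Config (Face uv.1 uv.2),
        nestedKernel (c (embed uv.1 uv.2 ρ)) (c (embed uv.1 uv.2 ρᶜ)) else 0 := by
  rw [nestedForm_eq_double_sum]
  exact twoCopy_eq_sum_faces p c nestedKernel

end Grouping

open Classical in
/-- **Lemma B implies the abstract C-005**: every face term is nonnegative. -/
theorem C005abstract_of_LemmaBAbstract (hB : LemmaBAbstract) : C005abstract := by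
  intro E _ _ p hp c hc
  rw [nestedForm_self_eq_sum_faces]
  refine Finset.sum_nonneg fun uv _ => ?_
  refine mul_nonneg (mul_nonneg (weight_nonneg hp _) (weight_nonneg hp _)) ?_
  split_ifs with hle
  · exact sum_crossKernel_compl_nonneg cross4_injective hB (fun ρ => c (embed uv.1 uv.2 ρ))
      (hc.comp (embed_mono uv.1 uv.2))
  · exact le_rfl

/-- **Lemma B implies C-005.** -/
theorem C005_of_LemmaBAbstract (hB : LemmaBAbstract) : C005 :=
  MultiGraph.C005_of_C005abstract (C005abstract_of_LemmaBAbstract hB)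

/-- **UFL (k = 3) implies C-005** — the lead's canonical chain, in Lean. -/
theorem C005_of_UFL3 (h : UFL3) : C005 := C005_of_LemmaBAbstract (LemmaBAbstract_of_UFL3 h)

/-- **The Hall form of Lemma B implies C-005** (p1's matching target). -/
theorem C005_of_HallForm (h : HallForm) : C005 :=
  C005_of_LemmaBAbstract (LemmaBAbstract_of_HallForm h)

end PercRepro
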